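/-
Origin: expansion seat `planner-pub-hodgecm-prl1-g4-0`, handover #9 2026-08-18T08:40:23Z (`HOME/pub-hodgecm-prl1-g4/lean/Prl1g4/AdelicTorusResidual.lean`, md5 d9ce90ea, 269 lines);
landed by the gen-7 packager in gate run 27 as `HodgeCM/Automorphic/AdelicTorusResidual.lean` (import ^import Prl1g4\.→import HodgeCM.Automorphic. ×1).
-/
/-
HodgeCM / automorphic layer — publication cell pub-hodgecm, EXPANSION PROVER a-1 (pub-hodgecm-prl1-g4, HANDOVER #9).
Imports my HANDOVER #8 `Prl1g4.AdelicTorusCompactInput` (the ONLY rewrite: ↦ `HodgeCM.Automorphic.AdelicTorusCompactInput`)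
and the run-26 TREE files `HodgeCM.PerL34.SeesawChars` (pv11-g5, cb167af1b394) and `HodgeCM.PerL34.AdelicUnitaryFactorisation`
(pv06-g4, 17a46a737890) — consumed BY NAME, nothing restated.
Complete proofs, no new axioms, no new hypotheses.
-/
import Summits.HodgeConjecture.HodgeCM.Automorphic.AdelicTorusCompactInput_2
import Summits.HodgeConjecture.HodgeCM.PerL34.SeesawChars_2
import Summits.HodgeConjecture.HodgeCM.PerL34.AdelicUnitaryFactorisation

/-!
# The residual block of the genuine tori, FILLED: only the data `(m₁, m₂, allowed)` remain

HANDOVER #8 left, per context and torus side, the residual block `Universe.AdelicRest L H φ` on the GENUINE adelic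
unitary group `U(W)(𝔸_L)`: the character bookkeeping `X, allowed, χᵥ, (m₁, m₂)`, the identifications
`emb, emb_spec, emb_surj`, and the finite-adelic block `Gf, ψ, comm, dense`.  This file PLUGS IN, by name,

* pv11-g5's `SeesawChars` (run 26): `X := ↥(SeesawTorus.allowedChars L m₁ m₂)` — the characters `ξ` of
  `[T] = T(𝔸)/T(L₀)` with `ξ_∞ = w(m₁, m₂)` —, `emb := allowedEmb` (the inclusion), `emb_spec := rfl`,
  `emb_surj := allowedEmb_surj'` (PerL ll. 425–427 for the genuine torus, PROVED there);
* pv06-g4's `AdelicUnitaryFactorisation` (run 26): `Gf := U(W)(𝔸_{L,f}) = Ufin L H`, `ψ := ιf`,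
  `comm := ιf_comm_of_map_snd`, `dense := dense_cosets` (real approximation, [Kneser1966] via pv06-g2's
  `dense_cosets_of_dictionary` — KERNEL over the vendored cone);

after proving the two facts they are owed (§14): the archimedean torus `T(L₀ ⊗ ℝ)` has TRIVIAL FINITE COMPONENT
through both embeddings `jT₁₂`, `jT₃₄ = g · jT · g⁻¹` (`map_snd_jT₁₂_toAdeles`, `map_snd_jT₃₄_toAdeles`), and the Gram
matrix `diag(a₀, a₁)` is hermitian with unit determinant (`gramW_conjTranspose`, `isUnit_det_gramW`).

Result (§15–§16): `Universe.SideData L := (m₁ m₂ : InfinitePlace L → ℤ) × (allowed : allowedChars → Prop)` is the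
ONLY thing left of a torus side — pure DATA (the archimedean type of `w = χ_∞` and PerL Def 3.2's allowed-pair
predicate) —, `AdelicRest.ofSide` builds the residual block from it, and the END STATE
`Assembly.realisationExists_ofSideData (M) (hP) (C) (d12 d34) (A) (hHR) : RealisationExistsPerL ∧ RealisationExistsFace`
carries NO torus-side hypothesis at all.
-/

set_option autoImplicit false

noncomputable section

open NumberField TopologicalSpace MeasureTheory Set Function
open scoped Topology Matrix

attribute [-instance] Quotient.instMeasurableSpace

namespace HodgeCM

/-! ## §14 The archimedean torus has trivial finite component; the Gram matrix of `W` -/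

namespace Adelic

section FiniteComponent

open HodgeCM.PerL34 HodgeCM.PerL34.TorusEmbedding HodgeCM.PerL34.DiagonalTorus

variable (L : Type) [Field L] [NumberField L] [IsCMField L]

omit [IsCMField L] in
/-- Conjugation preserves "finite component `= 1`": `(G X G⁻¹)_f = G_f X_f G_f⁻¹ = 1` if `X_f = 1`. -/
theorem map_snd_conj {n : Type} [Fintype n] [DecidableEq n] (G X : GL n (AdeleRing (𝓞 L) L))
    (hX : ((X : GL n (AdeleRing (𝓞 L) L)) : Matrix n n (AdeleRing (𝓞 L) L)).map Prod.snd = 1) :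
    (((G * X * G⁻¹ : GL n (AdeleRing (𝓞 L) L)) : Matrix n n (AdeleRing (𝓞 L) L))).map Prod.snd = 1 := by
  let f : AdeleRing (𝓞 L) L →+* IsDedekindDomain.FiniteAdeleRing (𝓞 L) L := RingHom.snd _ _
  have hf : ∀ M : Matrix n n (AdeleRing (𝓞 L) L), M.map Prod.snd = M.map ⇑f := fun _ => rfl
  rw [hf] at hX ⊢
  rw [Units.val_mul, Units.val_mul, Matrix.map_mul, Matrix.map_mul, hX, mul_one, ← Matrix.map_mul, Units.mul_inv,
    Matrix.map_one ⇑f (map_zero f) (map_one f)]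

/-- The first archimedean component `(t₁, 1)` has finite part `1` (tree `coe_infUnitsToIdele`, by `rfl`). -/
theorem snd_fst_toAdeles (t : SeesawArchTorus L) :
    ((((SeesawTorus.fst _ L (SeesawArchTorus.toAdeles L t) : relNormOneIdeles (maximalRealSubfield L) L) :
      ideleGroup L) : AdeleRing (𝓞 L) L)).2 = 1 := rfl

/-- The second archimedean component `(t₂, 1)` has finite part `1`. -/
theorem snd_snd_toAdeles (t : SeesawArchTorus L) :
    ((((SeesawTorus.snd _ L (SeesawArchTorus.toAdeles L t) : relNormOneIdeles (maximalRealSubfield L) L) :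
      ideleGroup L) : AdeleRing (𝓞 L) L)).2 = 1 := rfl

/-- **The archimedean torus has trivial finite component**: `diag(ιc t)_f = 1` in `GL₂(𝔸_{L,f})`
(`ιc t = ((t₁, 1), (t₂, 1))`, tree `coe_infUnitsToIdele`). -/
theorem map_snd_toGL_toAdeles (t : SeesawArchTorus L) :
    ((toGL L (SeesawArchTorus.toAdeles L t) : GL (Fin 2) (AdeleRing (𝓞 L) L)) :
      Matrix (Fin 2) (Fin 2) (AdeleRing (𝓞 L) L)).map Prod.snd = 1 := by
  rw [val_toGL]
  refine Matrix.ext fun i j => ?_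
  rw [Matrix.map_apply, Matrix.diagonal_apply, Matrix.one_apply]
  split_ifs with h
  · fin_cases i
    · exact snd_fst_toAdeles L t
    · exact snd_snd_toAdeles L t
  · rfl

variable {L} in
/-- The same for pv06-g3's `jT h = diag : T(𝔸) ↪ U(diag h)(𝔸)`. -/
theorem map_snd_jT_toAdeles (h : Fin 2 → L) (t : SeesawArchTorus L) :
    (((jT L h (SeesawArchTorus.toAdeles L t) : adelicUnitaryGroup L (Matrix.diagonal h)) :
      GL (Fin 2) (AdeleRing (𝓞 L) L)) : Matrix (Fin 2) (Fin 2) (AdeleRing (𝓞 L) L)).map Prod.snd = 1 :=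
  map_snd_toGL_toAdeles L t

end FiniteComponent

end Adelic

namespace StubTree.SeesawDatum

open HodgeCM.Adelic HodgeCM.PerL34
open Literature.AlgebraicGeometry.ShimuraVarieties (conjRingHomK)

variable {L : CMField} (S : StubTree.SeesawDatum L)

/-- `diag(a₀, a₁)` is hermitian: `(ᵗH̄) = H` (from `diag_isHermitian`, i.e. `SeesawDatum.a_real`). -/
theorem gramW_conjTranspose : (S.gramW.map (conjRingHomK L))ᵀ = S.gramW :=
  Matrix.ext fun i j => by
    rw [Matrix.transpose_apply, Matrix.map_apply]
    exact S.diag_isHermitian j i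

/-- `det diag(a₀, a₁) = a₀ a₁` is a unit (`SeesawDatum.a_ne`). -/
theorem isUnit_det_gramW : IsUnit S.gramW.det := by
  rw [Matrix.det_diagonal, isUnit_iff_ne_zero, Finset.prod_ne_zero_iff]
  intro i _
  fin_cases i
  · exact S.a_ne 0
  · exact S.a_ne 1

/-- `T(L₀ ⊗ ℝ)` has trivial finite component through `jT₁₂`. -/
theorem map_snd_jT₁₂_toAdeles (t : SeesawArchTorus L) :
    (((S.jT₁₂ (SeesawArchTorus.toAdeles (L : Type) t) : adelicUnitaryGroup L S.gramW) :
      GL (Fin 2) (AdeleRing (𝓞 L) L)) : Matrix (Fin 2) (Fin 2) (AdeleRing (𝓞 L) L)).map Prod.snd = 1 :=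
  map_snd_toGL_toAdeles (L : Type) t

/-- `T(L₀ ⊗ ℝ)` has trivial finite component through `jT₃₄ = g · jT · g⁻¹`. -/
theorem map_snd_jT₃₄_toAdeles (t : SeesawArchTorus L) :
    (((S.jT₃₄ (SeesawArchTorus.toAdeles (L : Type) t) : adelicUnitaryGroup L S.gramW) :
      GL (Fin 2) (AdeleRing (𝓞 L) L)) : Matrix (Fin 2) (Fin 2) (AdeleRing (𝓞 L) L)).map Prod.snd = 1 := by
  rw [coe_jT₃₄_apply]
  exact map_snd_conj (L : Type) _ _ (map_snd_toGL_toAdeles (L : Type) t)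

end StubTree.SeesawDatum

/-! ## §15 The residual block from the data `(m₁, m₂, allowed)` -/

namespace Universe

open HodgeCM.PerL34 HodgeCM.PerL34.Annihilation HodgeCM.PerL34.CompactTorusModel HodgeCM.Adelic
open HodgeCM.PerL34.AdelicUnitaryFactorisation
open Literature.AlgebraicGeometry.ShimuraVarieties (conjRingHomK)

/-- **The DATA of a torus side** (nothing else remains): the archimedean type `(m₁, m₂)` of the weight `w = χ_∞`
(PerL l. 424) and the allowed-pair predicate of PerL Def 3.2 on the characters of that type. -/
structure SideData (L : Type) [Field L] [NumberField L] [IsCMField L] where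
  /-- archimedean type on the first factor `U(W₁)` -/
  m₁ : InfinitePlace L → ℤ
  /-- archimedean type on the second factor `U(W₂)` -/
  m₂ : InfinitePlace L → ℤ
  /-- "arises from an allowed pair" (Def 3.2), on the characters of `[T]` of type `(m₁, m₂)` -/
  allowed : ↥(SeesawTorus.allowedChars L m₁ m₂) → Prop

section OfSide

variable (L : CMField) {n : Type} [Fintype n] [DecidableEq n] {H : Matrix n n L}
  (hH : (H.map (conjRingHomK L))ᵀ = H) (hdet : IsUnit H.det)
  (φ : SeesawTorus (maximalRealSubfield L) L →ₜ* adelicUnitaryGroup L H)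
  (hφ : ∀ t : SeesawArchTorus L,
    (((φ (SeesawArchTorus.toAdeles (L : Type) t) : adelicUnitaryGroup L H) : GL n (AdeleRing (𝓞 L) L)) :
      Matrix n n (AdeleRing (𝓞 L) L)).map Prod.snd = 1)
  (d : SideData L)

/-- **The residual block of a genuine torus side from its DATA**: characters and `emb` from pv11-g5's
`SeesawChars`, the finite-adelic block and the density from pv06-g4's `AdelicUnitaryFactorisation`. -/
def AdelicRest.ofSide : AdelicRest L H φ where
  X := ↥(SeesawTorus.allowedChars (L : Type) d.m₁ d.m₂)
  allowed := d.allowed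
  χv χ := ⟨fun t => dualChar χ.1 (QuotientGroup.mk t), (continuous_dualChar χ.1).comp QuotientGroup.continuous_mk⟩
  m₁ := d.m₁
  m₂ := d.m₂
  emb := SeesawTorus.allowedEmb (L : Type) d.m₁ d.m₂
  emb_spec _ _ := rfl
  emb_surj := SeesawTorus.allowedEmb_surj' d.m₁ d.m₂
  Gf := ↥(Ufin (L : Type) H)
  ψ := AdelicUnitaryFactorisation.ιf (L : Type) H
  comm k t := ιf_comm_of_map_snd (L : Type) H k _ (hφ t)
  dense := dense_cosets (L : Type) hH hdet (fun t => φ t) 1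

/-- (Ported verbatim from the HodgeCMPerL package; no docstring in the source.) -/
@[simp] theorem AdelicRest.ofSide_X : (AdelicRest.ofSide L hH hdet φ hφ d).X =
    ↥(SeesawTorus.allowedChars (L : Type) d.m₁ d.m₂) := rfl

/-- (Ported verbatim from the HodgeCMPerL package; no docstring in the source.) -/
@[simp] theorem AdelicRest.ofSide_Gf : (AdelicRest.ofSide L hH hdet φ hφ d).Gf = ↥(Ufin (L : Type) H) := rfl

/-- (Ported verbatim from the HodgeCMPerL package; no docstring in the source.) -/
theorem AdelicRest.ofSide_χv_apply (χ : ↥(SeesawTorus.allowedChars (L : Type) d.m₁ d.m₂))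
    (t : SeesawTorus (maximalRealSubfield L) L) :
    (AdelicRest.ofSide L hH hdet φ hφ d).χv χ t = dualChar χ.1 (QuotientGroup.mk t) := rfl

end OfSide

open HodgeCM.Prior.Perl34File HodgeCM.Prior.Perl34File.Perl34

/-- The (12) residual block of a context from its data. -/
abbrev arest12OfSide {L : CMField} (c : SeesawCtx L) (d : SideData L) : ARest12 c :=
  AdelicRest.ofSide L c.D.gramW_conjTranspose c.D.isUnit_det_gramW c.D.jT₁₂ c.D.map_snd_jT₁₂_toAdeles d

/-- The (34) residual block of a context from its data. -/
abbrev arest34OfSide {L : CMField} (c : SeesawCtx L) (d : SideData L) : ARest34 c :=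
  AdelicRest.ofSide L c.D.gramW_conjTranspose c.D.isUnit_det_gramW c.D.jT₃₄ c.D.map_snd_jT₃₄_toAdeles d

namespace AdelicTorusCore

variable {U : Universe} {hP : PrintFact_unitaryCompact} (C : U.AdelicTorusCore hP)

/-- `Rest12` of every context from the (12) side data. -/
abbrev side12 (d12 : ∀ {L : CMField}, SeesawCtx L → SideData L) {L : CMField} {ι₁ : L →+* ℂ}
    (V : HermSpace3 L ι₁) (c : SeesawCtx L) : C.Rest12 V c :=
  C.rest12OfAdelic (fun c => arest12OfSide c (d12 c)) V c

/-- `Rest34` of every context from the (34) side data. -/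
abbrev side34 (d34 : ∀ {L : CMField}, SeesawCtx L → SideData L) {L : CMField} {ι₁ : L →+* ℂ}
    (V : HermSpace3 L ι₁) (c : SeesawCtx L) : C.Rest34 V c :=
  C.rest34OfAdelic (fun c => arest34OfSide c (d34 c)) V c

end AdelicTorusCore

end Universe

/-! ## §16 END STATE: no torus-side hypothesis -/

namespace Assembly

open HodgeCM.PerL34
open HodgeCM.Prior.Perl34File HodgeCM.Prior.Perl34File.Perl34
open HodgeCM.Universe (AdelicTorusCore SideData ThetaModel)

variable (U : Universe)

/-- **Both realisation inputs of part (a) — `RealisationExistsPerL ∧ RealisationExistsFace` — over the adelic unitary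
groups with PerL's GENUINE tori, their compact quotient models, their characters and the finite-adelic
factorisation.**  Hypotheses: the model facts `M`; the compactness criterion `hP` [PRINT, Margulis 1991 I.3.2.1(b)];
the core DATA `C` (`emb`, `cover`, sign recipe, Weil theta models, theta one-forms); per context the torus-side DATA
`d12 c`, `d34 c` (archimedean types + allowed-pair predicates); the ten theta `Inputs`; Hodge–Riemann.
NO torus-side hypothesis: `unfold`, `fourier`, `PT_cov`, `res_*`, smoothing (pv15-g2), `β` (§11 of #8), `exists_fd`,
compactness of `[T]` (pv11-g5 / pv09-g4), `emb_surj` (pv11-g5), `comm`, `dense` (pv06-g4, §14) are THEOREMS. -/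
theorem realisationExists_ofSideData (M : U.ModelAxioms) (hP : PrintFact_unitaryCompact)
    (C : U.AdelicTorusCore hP) (d12 d34 : ∀ {L : CMField}, SeesawCtx L → SideData L)
    (A : (ThetaModel.ofRegCarrier (C.rtc (C.side12 d12) (C.side34 d34))
      (C.analyticKM (C.side12 d12) (C.side34 d34)).toAnalytic).Inputs)
    (hHR : U.Fact_hodgeRiemann20) : U.RealisationExistsPerL ∧ U.RealisationExistsFace :=
  realisationExists_ofAdelicTorusCompactRest U M hP C (C.side12 d12) (C.side34 d34) A hHR

/-- **PerL with no torus-side hypothesis.** -/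
theorem perL_ofSideData (M : U.ModelAxioms) (hP : PrintFact_unitaryCompact)
    (C : U.AdelicTorusCore hP) (d12 d34 : ∀ {L : CMField}, SeesawCtx L → SideData L)
    (A : (ThetaModel.ofRegCarrier (C.rtc (C.side12 d12) (C.side34 d34))
      (C.analyticKM (C.side12 d12) (C.side34 d34)).toAnalytic).Inputs)
    (hHR : U.Fact_hodgeRiemann20) : U.PerL :=
  perL_ofAdelicTorusCompactRest U M hP C (C.side12 d12) (C.side34 d34) A hHR

/-- **COR-CM, END STATE with no torus-side hypothesis.** -/
theorem COR_CM_endState_ofSideData (M : U.ModelAxioms) (h29 : U.Fact_weightSpan)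
    (h30 : U.Fact_weightHodge) (hE : U.Qw8ExtProd) (hD : U.Qw8DualPushPull) (hMi : U.Qw8Milne)
    (hP : PrintFact_unitaryCompact) (C : U.AdelicTorusCore hP)
    (d12 d34 : ∀ {L : CMField}, SeesawCtx L → SideData L)
    (A : (ThetaModel.ofRegCarrier (C.rtc (C.side12 d12) (C.side34 d34))
      (C.analyticKM (C.side12 d12) (C.side34 d34)).toAnalytic).Inputs)
    (hHR : U.Fact_hodgeRiemann20) : U.HC_CM :=
  COR_CM_endState_ofAdelicTorusCompactRest U M h29 h30 hE hD hMi hP C (C.side12 d12) (C.side34 d34) A hHR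

end Assembly

end HodgeCM

end
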